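import Summits.QuantumFields.YangMills.Theorems.DressedRitz.Negative.DressedMixtureHazard
import HarnessLib

/-!
# Route `LuscherReduction`, crux `DressedRitz` (stmt-QuantumFields-20205), line «polyakovlift» r5 — NEGATIVE lane:
# the dressed tower pair — readable necessary conditions behind (o4) and (o5) for the time-dressed family

Negative-side support lemmas of the standing disprover (seat `ym-cdisprove-20205-1`, GEN 3), sequel of `…/Negative/DressedMixtureHazard.lean` (p541427:
closed forms for the dressed two-level mixture `v_m = K_β^[m](ψ₁ + s•ψ₂) = κ₁^m•ψ₁ + (sκ₂^m)•ψ₂`).  This file turns the closed forms into the two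
inequalities a prover of S-LEAK (o4) ∕ S-POS-core (o5) must actually beat, and records in the kernel why the registered dressing depth `m = L` does not
beat them on the LOW TOWER by itself.  Nothing here asserts or refutes a route item.

* §1 `pow_ge_one_sub_mul` (Bernoulli: `1 − n(1−r) ≤ r^n` for `r ≥ 0`), ★ `dressingWeight_ge_half`: if the
  ratio of two levels satisfies `1 − r ≤ a` and `2na ≤ 1` then `r^n ≥ 1/2` — for two members of the low tower (`1 − r ≍ Δε·Λ/L`, RED (R3)) and the
  registered depth `n = 2L` this reads `4ΔεΛ ≤ 1`: deep in the femto window the dressing `K_β^[L]` changes the relative weight of a tower neighbour by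
  AT MOST A FACTOR 2.  (For a HARD admixture, `1 − r = O(1)`, `r^{2L} = e^{−O(L)}` — the sector the dressing was introduced for; lead's `HAZARD-S-LEAK-UV.md`,
  s1's `hardSector_le_of_window`, p541272.)
* §2 ★★ `not_leakageClause_of_dressedTowerPair`: for the dressed EQUAL mixture `K_β^[m](ψ₁ + ψ₂)` of two exact levels `0 < κ₂ ≤ κ₁` whose dressed
  weights are still comparable (`κ₁^{2m} ≤ 2κ₂^{2m}`, i.e. `r^{2m} ≥ 1/2`), clause (o4) FAILS as soon as `8·C(Λ³/L²)λ₀² < (κ₁ − κ₂)²` — g0's undressed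
  `not_leakageClause_of_mixture` had the constant `4`; the dressing costs a factor 2 and nothing else.  With `κ₁ − κ₂ ≍ λ₀ΔεΛ/L` the condition is
  `8CΛ < Δε²`: true deep in the window.  The `∀`-basis hazard (T2) of the disprover's g0 file therefore stands VERBATIM for the r3∕r5 dressed family;
  its discharge is unchanged (crux ONE's non-crossing for distinct `ε`, Schur ∕ isotypic separation inside a shell — `DoubletRotationVoid.lean`,
  infvol-p1's reflections and parity p537537 ∕ p541342).
* §3 ★★ `not_dynamicCoreClauses_of_weight_gap`: under perfect level universality (`μ₁(B)·λ₀ = κ₁·μ₀(B)`), if the dressed vector keeps leakage weight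
  at least `δ` on the lower level (`δ·‖v‖² ≤ s²κ₂^{2m}`) at relative gap at least `γ` (`γκ₁ ≤ κ₁ − κ₂`), then (o5) FAILS whenever `CΛ²/L < δγ`
  (`δ, γ ≥ 0`, `κ₁ > 0`).  Reading: tower neighbour `γ ≍ ΔεΛ/L` ⇒ the admissible dressed leakage weight is `δ ≲ CΛ/Δε` — single-level CONCENTRATION of
  every channel vector (NEAR), not only level POSITIONS, is what (o5) ∕ (A5) ∕ (E5) ask; one-loop eigenvector corrections give `δ = O(λ²)`, one power
  to spare; by §1 the dressing does not manufacture this concentration on the tower, it only removes the hard sector.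

HONEST FRAMING: fixed-lattice two-level algebra about hypotheses of stubs of a child of the CONDITIONAL reduction route R2b1; no stub is closed or refuted;
nothing here bears on infinite volume, the continuum limit or the Clay mass gap.
References: M. Lüscher, U. Wolff, NPB 339 (1990) 222 [cite: LuscherWolff1990]; M. Lüscher, NPB 219 (1983) 233 [cite: Luscher1983, §3].
-/

set_option autoImplicit false

noncomputable section

open MeasureTheory Filter Topology Real
open Literature.MathematicalPhysics.QuantumFieldTheory (GaugeConfig Site gaugeTransform)
open scoped BigOperators

namespace Summit.QuantumFields.YangMills.Theorems.FemtoTransferGap.PolyakovLift.Negative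

open Summit.QuantumFields.YangMills.Theorems.FemtoTransferGap
open Summit.QuantumFields.YangMills.Theorems.FemtoTransferGap.PolyakovLift

/-! ## §1 Elementary bound: the dressing weight `r^n ≥ 1 − n(1−r)` (the tolerance bound `1 − e^{−c} ≤ c` is inlined in §3; tree: `PrimeReciprocal.one_sub_exp_neg_le`) -/

/-- Bernoulli: `1 − n(1 − r) ≤ r^n` for `r ≥ 0`. [folklore] -/
theorem pow_ge_one_sub_mul {r : ℝ} (hr : 0 ≤ r) (n : ℕ) : 1 - (n : ℝ) * (1 - r) ≤ r ^ n := by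
  have h := one_add_mul_le_pow (a := r - 1) (by linarith) n
  have h1 : (1 : ℝ) + (r - 1) = r := by ring
  rw [h1] at h
  linarith

/-- ★ **The dressing re-weights tower neighbours by at most a factor 2**: `1 − r ≤ a`, `2na ≤ 1`, `0 ≤ r` ⇒ `1/2 ≤ r^n`.  (Tower neighbours in the
window: `a ≍ ΔεΛ/L`, `n = 2L` ⇒ the condition is `4ΔεΛ ≤ 1`.) [folklore] -/
theorem dressingWeight_ge_half {r a : ℝ} (hr : 0 ≤ r) (hra : 1 - r ≤ a) (n : ℕ) (hna : 2 * (n : ℝ) * a ≤ 1) :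
    1 / 2 ≤ r ^ n := by
  have hB := pow_ge_one_sub_mul hr n
  have hn : (0 : ℝ) ≤ n := Nat.cast_nonneg n
  have h2 : (n : ℝ) * (1 - r) ≤ (n : ℝ) * a := mul_le_mul_of_nonneg_left hra hn
  linarith

/-! ## §2 (o4) on a dressed tower pair with comparable dressed weights -/

section TowerPair

variable {L : ℕ} [NeZero L] (β : ℝ) {ψ₁ ψ₂ : GaugeConfig 3 L SU2 → ℝ} {κ₁ κ₂ : ℝ}

/-- ★★ **(o4) fails for the dressed equal mixture of two comparable-weight levels under g0's gap condition (constant 8 for 4).**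
`v = K_β^[m](ψ₁ + ψ₂)`, `0 < κ₂ ≤ κ₁`, `κ₁^{2m} ≤ 2κ₂^{2m}`, `8·C(Λ³/L²)λ₀² < (κ₁ − κ₂)²` ⇒ `¬ LeakageClause 1 C β (fun _ ↦ v)`. [cite: LuscherWolff1990] -/
theorem not_leakageClause_of_dressedTowerPair (C : ℝ) (h₁ : IsPhys ψ₁) (h₂ : IsPhys ψ₂)
    (he₁ : transferApply β ψ₁ = κ₁ • ψ₁) (he₂ : transferApply β ψ₂ = κ₂ • ψ₂)
    (hn₁ : l2 ψ₁ ψ₁ = 1) (hn₂ : l2 ψ₂ ψ₂ = 1) (h₁₂ : l2 ψ₁ ψ₂ = 0) (m : ℕ)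
    (hκ₂ : 0 < κ₂) (hle : κ₂ ≤ κ₁) (hw : κ₁ ^ (2 * m) ≤ 2 * κ₂ ^ (2 * m))
    (hgap : 8 * (C * (luscherLambda β L ^ 3 / (L : ℝ) ^ 2) * levelValue su2Rep L β 0 ^ 2) < (κ₁ - κ₂) ^ 2) :
    ¬ LeakageClause 1 C β (fun _ => (transferApply (L := L) β)^[m] (ψ₁ + ψ₂)) := by
  have h1 : ψ₁ + ψ₂ = ψ₁ + (1 : ℝ) • ψ₂ := by rw [one_smul]
  rw [h1, leakageClause_dressedMixture_iff β C h₁ h₂ he₁ he₂ hn₁ hn₂ h₁₂ 1 m, not_le, one_pow, one_mul, one_mul]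
  have hk1 : 0 < κ₁ ^ (2 * m) := pow_pos (hκ₂.trans_le hle) _
  have hk2 : 0 < κ₂ ^ (2 * m) := pow_pos hκ₂ _
  have hw' : κ₂ ^ (2 * m) ≤ κ₁ ^ (2 * m) := pow_le_pow_left₀ hκ₂.le hle _
  have hprod : (κ₁ * κ₂) ^ (2 * m) = κ₁ ^ (2 * m) * κ₂ ^ (2 * m) := mul_pow _ _ _
  have hP : 0 < (κ₁ * κ₂) ^ (2 * m) := by rw [hprod]; exact mul_pos hk1 hk2
  -- the squared Gram number is at most `8 (κ₁κ₂)^{2m}`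
  have hn2 : (κ₁ ^ (2 * m) + κ₂ ^ (2 * m)) ^ 2 ≤ 8 * (κ₁ * κ₂) ^ (2 * m) := by
    rw [hprod]
    nlinarith [mul_le_mul_of_nonneg_left hw hk1.le, hw', hk1, hk2]
  set T := C * (luscherLambda β L ^ 3 / (L : ℝ) ^ 2) * levelValue su2Rep L β 0 ^ 2 with hT
  by_cases hT0 : 0 ≤ T
  · calc T * (κ₁ ^ (2 * m) + κ₂ ^ (2 * m)) ^ 2 ≤ T * (8 * (κ₁ * κ₂) ^ (2 * m)) := mul_le_mul_of_nonneg_left hn2 hT0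
      _ = 8 * T * (κ₁ * κ₂) ^ (2 * m) := by ring
      _ < (κ₁ - κ₂) ^ 2 * (κ₁ * κ₂) ^ (2 * m) := mul_lt_mul_of_pos_right hgap hP
      _ = (κ₁ * κ₂) ^ (2 * m) * (κ₁ - κ₂) ^ 2 := by ring
  · have hTn : T < 0 := lt_of_not_ge hT0
    have hsq : 0 < (κ₁ ^ (2 * m) + κ₂ ^ (2 * m)) ^ 2 := by positivity
    have hl : T * (κ₁ ^ (2 * m) + κ₂ ^ (2 * m)) ^ 2 < 0 := mul_neg_of_neg_of_pos hTn hsq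
    have hr : 0 ≤ (κ₁ * κ₂) ^ (2 * m) * (κ₁ - κ₂) ^ 2 := mul_nonneg hP.le (sq_nonneg _)
    linarith

/-! ## §3 (o5) — leakage weight times relative gap must stay below the tolerance -/

/-- ★★ **(o5) fails when (dressed leakage weight) × (relative gap) exceeds `CΛ²/L`.**  `v = K_β^[m](ψ₁ + s•ψ₂)`, perfect level universality
`μ₁(B)·λ₀ = κ₁·μ₀(B)`, `μ₀(B) > 0`, `κ₁ > 0`; weight `δ ≥ 0` with `δ‖v‖² ≤ s²κ₂^{2m}`, gap `γ ≥ 0` with `γκ₁ ≤ κ₁ − κ₂`; `CΛ²/L < δγ` ⇒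
`¬ DynamicCoreClauses 1 C β (fun _ ↦ v)`. [cite: Luscher1983, §3] -/
theorem not_dynamicCoreClauses_of_weight_gap (C : ℝ) (h₁ : IsPhys ψ₁) (h₂ : IsPhys ψ₂)
    (he₁ : transferApply β ψ₁ = κ₁ • ψ₁) (he₂ : transferApply β ψ₂ = κ₂ • ψ₂)
    (hn₁ : l2 ψ₁ ψ₁ = 1) (hn₂ : l2 ψ₂ ψ₂ = 1) (h₁₂ : l2 ψ₁ ψ₂ = 0) (s : ℝ) (m : ℕ)
    (hm0 : 0 < levelValue su2Rep 1 (oneSiteCoupling β L) 0)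
    (hlev : levelValue su2Rep 1 (oneSiteCoupling β L) 1 * levelValue su2Rep L β 0 = κ₁ * levelValue su2Rep 1 (oneSiteCoupling β L) 0)
    (hκ₁ : 0 < κ₁) {δ γ : ℝ} (hδ : 0 ≤ δ) (hγ : 0 ≤ γ)
    (hweight : δ * (κ₁ ^ (2 * m) + s ^ 2 * κ₂ ^ (2 * m)) ≤ s ^ 2 * κ₂ ^ (2 * m))
    (hgapRel : γ * κ₁ ≤ κ₁ - κ₂)
    (htol : C * luscherLambda β L ^ 2 / L < δ * γ) :
    ¬ DynamicCoreClauses 1 C β (fun _ => (transferApply (L := L) β)^[m] (ψ₁ + s • ψ₂)) := by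
  refine not_dynamicCoreClauses_of_dressedMixture β C h₁ h₂ he₁ he₂ hn₁ hn₂ h₁₂ s m hm0 hlev ?_
  set c := C * luscherLambda β L ^ 2 / L with hc
  set n := κ₁ ^ (2 * m) + s ^ 2 * κ₂ ^ (2 * m) with hn
  have hE : 0 < Real.exp c := Real.exp_pos c
  have hn0 : 0 < n := by
    have : 0 ≤ s ^ 2 * κ₂ ^ (2 * m) := by
      have h2m : κ₂ ^ (2 * m) = (κ₂ ^ m) ^ 2 := by rw [← pow_mul, mul_comm]
      rw [h2m]; positivity
    have hk1 : 0 < κ₁ ^ (2 * m) := pow_pos hκ₁ _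
    linarith
  -- `1 − e^{−c} ≤ c < δγ`, and `δγ·κ₁·n ≤ s²κ₂^{2m}(κ₁ − κ₂)`
  have h1 : 1 - Real.exp (-c) ≤ c := by
    have h := Real.add_one_le_exp (-c)
    linarith
  have hkey : δ * γ * (κ₁ * n) ≤ s ^ 2 * κ₂ ^ (2 * m) * (κ₁ - κ₂) := by
    calc δ * γ * (κ₁ * n) = (δ * n) * (γ * κ₁) := by ring
      _ ≤ (s ^ 2 * κ₂ ^ (2 * m)) * (κ₁ - κ₂) :=
          mul_le_mul hweight hgapRel (mul_nonneg hγ hκ₁.le) (le_trans (mul_nonneg hδ hn0.le) hweight)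
      _ = s ^ 2 * κ₂ ^ (2 * m) * (κ₁ - κ₂) := by ring
  have hκn : 0 < κ₁ * n := mul_pos hκ₁ hn0
  -- `(e^c − 1) = e^c (1 − e^{−c}) ≤ e^c · c < e^c · δγ`
  have hexp : Real.exp c - 1 = Real.exp c * (1 - Real.exp (-c)) := by
    rw [mul_sub, mul_one, ← Real.exp_add, add_neg_cancel, Real.exp_zero]
  have hlt : (Real.exp c - 1) * (κ₁ * n) < Real.exp c * (δ * γ * (κ₁ * n)) := by
    rw [hexp]
    have : (1 - Real.exp (-c)) * (κ₁ * n) < δ * γ * (κ₁ * n) :=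
      mul_lt_mul_of_pos_right (lt_of_le_of_lt h1 htol) hκn
    calc Real.exp c * (1 - Real.exp (-c)) * (κ₁ * n) = Real.exp c * ((1 - Real.exp (-c)) * (κ₁ * n)) := by ring
      _ < Real.exp c * (δ * γ * (κ₁ * n)) := mul_lt_mul_of_pos_left this hE
  calc (Real.exp c - 1) * (κ₁ * n) < Real.exp c * (δ * γ * (κ₁ * n)) := hlt
    _ ≤ Real.exp c * (s ^ 2 * κ₂ ^ (2 * m) * (κ₁ - κ₂)) := mul_le_mul_of_nonneg_left hkey hE.le

end TowerPair

end Summit.QuantumFields.YangMills.Theorems.FemtoTransferGap.PolyakovLift.Negative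

end
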